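import Summits.CriticalPhenomena.PercolationContinuityZ3.Theorems.PercNearOneGluingNoHeavyLowerTailThreePointProductFormHubRun
import Summits.CriticalPhenomena.PercolationContinuityZ3.Theorems.PercNearOneGluingNoHeavyLowerTailThreePointProductFormModuleTemplates

/-!
# The box theorem in ORBIT FORM: the hub column is slaved to the visible column plus a pure module orbit,
# `m̂₊ = (3/5)·m₋ + (8/3)·M_w w₀`, and the visible column's sources are the two orbit seeds `w₀ = (−39/800, 3/200, 0)`, `e_z`
# (Sahi programme, one-child boundary-star cycle, prover prim-sahi-p2 gen 74)

Support file (`--supports stmt-CriticalPhenomena-4575`).  Standard axioms, no sorries, no named facts, no new definitions.  Memo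
`run/shared/lean/prim/prim-sahi/FROM-prim-sahi-p2-gen74-HUB-RUNS.md` §8 (addendum), `prim-sahi-p2/PROOF-E3.md` §84(i).

With the corrected hub column `m̂₊ = colPhat = m₊ + t·w₀` of `…ThreePointProductFormHubRun` (`w₀ = (−39/800, 3/200, 0)`) and the module letter
`M(s,d) = mSD s d` of `…ThreePointProductFormModuleCone`, for EVERY letter `(s,d)` (not only the hub):
* `colM_bstepA_seeds` — the visible column moves by `m₋ ↦ M(s,d)m₋ + t·[(5/12)d²·w₀ − (3/640)sd·e_z]`: its two sources are the seeds `w₀` and `e_z = (0,0,1)`;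
* `colPhat_bstepA_seeds` — the corrected hub column moves by `m̂₊ ↦ M(s,d)m̂₊ + (3/5)·t·[(5/12)d²·w₀ − (3/640)sd·e_z]`: EXACTLY `3/5` of the visible source;
* ★ `colPhat_eq_orbit` — hence along every word `m̂₊(state w) = (3/5)·m₋(state w) + (8/3)·M_w w₀` (`M_w w₀ = iterSD w w₀`, a PURE ORBIT with no source), and
  `col3_eq_orbit`: `m³(state w) = M_w (0,0,−1/10)`;
* ★ `boxval_append_orbit` — THE PAIR IDENTITY IN ORBIT FORM: with `v = state(ũ)`, `v' = state(w)`, `O = M_ũ w₀`, `O' = M_w w₀`,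
  `A[u++w] = (117/64)tt' + (135/112)(tG'+Gt') + 14400·β𝕄(m₋,m'₋) + 32000·[β𝕄(O, m'₋) + β𝕄(m₋, O')] + 300β𝕄(m³,m'³) − 12εε'`:
  besides the scalars `t, G, ε` the whole AM form is carried by ONE sourced column `m₋` (LEMMA ψ's column, `L₊(m₋) ≤ 0` by the visible sign law) and
  the two pure orbits of `w₀` and `e_z` under the same letters.
[this work] (gen 74).
-/

namespace Summit.CriticalPhenomena.PercolationContinuityZ3.Theorems.ProductFormABPlus

open ProductFormCorners (V3)
open ProductFormModuleCone (mSD iterSD)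
open ProductFormModuleCP (col3_bstepB)

/-- The visible column's one-step law with its sources written in the seeds `w₀ = (−39/800, 3/200, 0)` and `e_z`:
`m₋(N_θ v) = M(s,d)·m₋(v) + t·[(5/12)d²·w₀ − (3/640)sd·e_z]`. [this work] -/
theorem colM_bstepA_seeds (s d : ℚ) (v : StA) :
    colM (bstepA s d v) =
      ⟨(mSD s d (colM v)).x + v.t * ((5/12) * d ^ 2 * (-(39/800))),
       (mSD s d (colM v)).y + v.t * ((5/12) * d ^ 2 * (3/200)),
       (mSD s d (colM v)).z + v.t * (-(3/640) * (s * d))⟩ := by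
  ext <;> simp [colM, bstepA, combA, stepA, mSD] <;> ring

/-- The corrected hub column's one-step law: the SAME source scaled by `3/5`:
`m̂₊(N_θ v) = M(s,d)·m̂₊(v) + (3/5)·t·[(5/12)d²·w₀ − (3/640)sd·e_z]`. [this work] -/
theorem colPhat_bstepA_seeds (s d : ℚ) (v : StA) :
    colPhat (bstepA s d v) =
      ⟨(mSD s d (colPhat v)).x + (3/5) * v.t * ((5/12) * d ^ 2 * (-(39/800))),
       (mSD s d (colPhat v)).y + (3/5) * v.t * ((5/12) * d ^ 2 * (3/200)),
       (mSD s d (colPhat v)).z + (3/5) * v.t * (-(3/640) * (s * d))⟩ := by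
  ext <;> simp [colPhat, colP, bstepA, combA, stepA, mSD] <;> ring

/-- `mSD` is linear (used to split orbits): `M(a·x + b·y) = a·Mx + b·My` componentwise. [this work] -/
theorem mSD_lin (s d a b : ℚ) (x y : V3) :
    mSD s d ⟨a * x.x + b * y.x, a * x.y + b * y.y, a * x.z + b * y.z⟩ =
      ⟨a * (mSD s d x).x + b * (mSD s d y).x, a * (mSD s d x).y + b * (mSD s d y).y, a * (mSD s d x).z + b * (mSD s d y).z⟩ := by
  ext <;> simp [mSD] <;> ring

/-- ★ THE COLUMN IDENTITY.  Along every word, `m̂₊ = (3/5)·m₋ + (8/3)·M_w w₀` with the pure orbit `M_w w₀ = iterSD w (−39/800, 3/200, 0)`. [this work] -/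
theorem colPhat_eq_orbit (w : List (ℚ × ℚ)) :
    colPhat (brunA w omegaA) =
      ⟨(3/5) * (colM (brunA w omegaA)).x + (8/3) * (iterSD w ⟨-(39/800), 3/200, 0⟩).x,
       (3/5) * (colM (brunA w omegaA)).y + (8/3) * (iterSD w ⟨-(39/800), 3/200, 0⟩).y,
       (3/5) * (colM (brunA w omegaA)).z + (8/3) * (iterSD w ⟨-(39/800), 3/200, 0⟩).z⟩ := by
  induction w with
  | nil =>
    ext <;> simp [colPhat, colP, colM, brunA, omegaA, iterSD] <;> norm_num
  | cons θ w ih =>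
    simp only [brunA, iterSD]
    rw [colPhat_bstepA_seeds, colM_bstepA_seeds, ih, mSD_lin]
    ext <;> simp only <;> ring

/-- The third column is the pure orbit of `(0, 0, −1/10)`: `m³(state w) = M_w (0,0,−1/10)`. [this work] -/
theorem col3_eq_orbit (w : List (ℚ × ℚ)) : col3 (brunB w omegaB) = iterSD w ⟨0, 0, -(1/10)⟩ := by
  induction w with
  | nil => ext <;> simp [col3, brunB, omegaB, iterSD]
  | cons θ w ih => simp only [brunB, iterSD]; rw [col3_bstepB, ih]

/-- `β𝕄` against a `(3/5, 8/3)`-combination on the left (bookkeeping). [this work] -/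
theorem betaM_comb_left (m o b : V3) :
    betaM ⟨(3/5) * m.x + (8/3) * o.x, (3/5) * m.y + (8/3) * o.y, (3/5) * m.z + (8/3) * o.z⟩ b =
      (3/5) * betaM m b + (8/3) * betaM o b := by
  simp only [betaM]; ring

/-- `β𝕄` against a `(3/5, 8/3)`-combination on the right (bookkeeping). [this work] -/
theorem betaM_comb_right (b m o : V3) :
    betaM b ⟨(3/5) * m.x + (8/3) * o.x, (3/5) * m.y + (8/3) * o.y, (3/5) * m.z + (8/3) * o.z⟩ =
      (3/5) * betaM b m + (8/3) * betaM b o := by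
  simp only [betaM]; ring

/-- ★ THE PAIR IDENTITY IN ORBIT FORM.  For all words `u, w`, with `v = state(reverse u)`, `v' = state(w)`, `O = M_{ũ} w₀`, `O' = M_w w₀`:
`A[u++w] = (117/64)tt' + (135/112)(tG'+Gt') + 14400·β𝕄(m₋,m'₋) + 32000·[β𝕄(O,m'₋) + β𝕄(m₋,O')] + 300β𝕄(m³,m'³) − 12εε'`. [this work] -/
theorem boxval_append_orbit (u w : List (ℚ × ℚ)) :
    boxval (u ++ w) =
      (117/64) * (brunA u.reverse omegaA).t * (brunA w omegaA).t
      + (135/112) * ((brunA u.reverse omegaA).t * (zOf (brunA w omegaA)).G + (zOf (brunA u.reverse omegaA)).G * (brunA w omegaA).t)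
      + 14400 * betaM (colM (brunA u.reverse omegaA)) (colM (brunA w omegaA))
      + 32000 * (betaM (iterSD u.reverse ⟨-(39/800), 3/200, 0⟩) (colM (brunA w omegaA))
          + betaM (colM (brunA u.reverse omegaA)) (iterSD w ⟨-(39/800), 3/200, 0⟩))
      + (300 * betaM (col3 (brunB u.reverse omegaB)) (col3 (brunB w omegaB))
          - 12 * (brunB u.reverse omegaB).E4 * (brunB w omegaB).E4) := by
  rw [boxval_append_hat, colPhat_eq_orbit, colPhat_eq_orbit, betaM_comb_left, betaM_comb_right]
  ring

/-- The one-sided orbit form: `A[w] = (33/8)t + (45/14)G + 32000·β𝕄(w₀, m₋) − 30ζ − 12ε` (`w₀ = (−39/800, 3/200, 0)`; cf. `alphaA_hat`). [this work] -/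
theorem boxval_orbit (w : List (ℚ × ℚ)) :
    boxval w = (33/8) * (brunA w omegaA).t + (45/14) * (zOf (brunA w omegaA)).G
      + 32000 * betaM ⟨-(39/800), 3/200, 0⟩ (colM (brunA w omegaA))
      - 30 * (brunB w omegaB).E5 - 12 * (brunB w omegaB).E4 := by
  unfold boxval
  rw [alphaA_hat]
  simp only [alphaB]
  ring

end Summit.CriticalPhenomena.PercolationContinuityZ3.Theorems.ProductFormABPlus
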